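import Summits.FinalStateConjecture.FinalStateConjecture.Theses.SignedCensus

/-!
# Route SignedCensus — support item `CensusUniqueness`

Item `stmt-FinalStateConjecture-10005` of route `SignedCensus` for the Final State Conjecture: the
abstract "census" lemma in its no-fold form,

> a proper local homeomorphism `chart : 𝔐 → B` from a Hausdorff space to a connected space, one of
> whose fibres is a single point, is injective.

## Proof

Elementary point-set topology; no counting of sheets is needed. Let
`S := {b : B | ∃! m, chart m = b}` be the set of points covered exactly once.

* `S` is open (`isOpen_setOf_existsUnique_preimage`): if `m` is the unique preimage of `b`, pick an
  open set `U ∋ m` on which `chart` is injective (a local homeomorphism is locally injective).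
  `chart '' Uᶜ` is closed (a proper map is closed) and misses `b`, and `chart '' U` is open (a local
  homeomorphism is open); every point of the open neighbourhood `chart '' U ∩ (chart '' Uᶜ)ᶜ` of `b`
  has exactly one preimage.
* `Sᶜ` is open (`isClosed_setOf_existsUnique_preimage`): a point with no preimage lies in the open
  set `(range chart)ᶜ` (a proper map has closed range); a point with two preimages `m₁ ≠ m₂` lies in
  `chart '' U₁ ∩ chart '' U₂` for disjoint open sets `U₁ ∋ m₁`, `U₂ ∋ m₂` (`𝔐` is Hausdorff), all of
  whose points have two distinct preimages.
* `B` is connected and `S` is nonempty by hypothesis, so `S = B`; hence `chart` is injective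
  (indeed bijective).

Only closedness (of the map and of its range) is used from properness, and the Hausdorff hypothesis
on `B` in the item is not needed. Background: the finite-covering folklore for proper local
homeomorphisms cited by the route ([Ho 1975, doi:10.2307/2039880]; [arXiv:0909.4550]); nothing is
imported from it.
-/

-- every `Summit.FinalStateConjecture.FinalStateConjecture.…` name repeats the summit = sub-problem
-- segment (D-0017 layout, CONVENTIONS §2; lakefile sets it for the library build, a standalone
-- elaboration of this file does not see that option); the duplicate is deliberate.
set_option linter.dupNamespace false

namespace Summit.FinalStateConjecture.FinalStateConjecture.Theorems

namespace SignedCensus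

open Set

section UniquelyCovered

variable {X Y : Type*} [TopologicalSpace X] [TopologicalSpace Y] {f : X → Y}

/-- For a closed, open and locally injective map `f : X → Y`, the set of points of `Y` with exactly
one preimage under `f` is open. -/
theorem isOpen_setOf_existsUnique_preimage (hc : IsClosedMap f) (ho : IsOpenMap f)
    (hi : IsLocallyInjective f) : IsOpen {y : Y | ∃! x, f x = y} := by
  rw [isOpen_iff_forall_mem_open]
  rintro y ⟨x, rfl, hx⟩
  obtain ⟨U, hUo, hxU, hU⟩ := hi x
  refine ⟨f '' U ∩ (f '' Uᶜ)ᶜ, ?_, (ho U hUo).inter (hc _ hUo.isClosed_compl).isOpen_compl,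
    ⟨mem_image_of_mem f hxU, ?_⟩⟩
  · rintro _ ⟨⟨x', hx'U, rfl⟩, hy⟩
    refine ⟨x', rfl, fun x'' hx'' ↦ ?_⟩
    have hx''U : x'' ∈ U := by
      by_contra h
      exact hy ⟨x'', h, hx''⟩
    exact hU hx''U hx'U hx''
  · rintro ⟨x', hx'U, hx'⟩
    exact hx'U (by rw [hx x' hx']; exact hxU)

/-- For an open map `f : X → Y` with closed range out of a Hausdorff space, the set of points of `Y`
with exactly one preimage under `f` is closed: its complement, the set of points with no preimage or
with two distinct preimages, is open. -/
theorem isClosed_setOf_existsUnique_preimage [T2Space X] (hr : IsClosed (range f))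
    (ho : IsOpenMap f) : IsClosed {y : Y | ∃! x, f x = y} := by
  rw [← isOpen_compl_iff, isOpen_iff_forall_mem_open]
  intro y hy
  by_cases hex : ∃ x, f x = y
  · obtain ⟨x₁, rfl⟩ := hex
    -- a second preimage, distinct from `x₁`
    have hnu : ¬ ∀ x₂, f x₂ = f x₁ → x₂ = x₁ := fun h ↦ hy ⟨x₁, rfl, h⟩
    obtain ⟨x₂, hx₂⟩ := not_forall.mp hnu
    obtain ⟨hfx₂, hne⟩ := Classical.not_imp.mp hx₂
    obtain ⟨U, V, hUo, hVo, hx₂U, hx₁V, hUV⟩ := t2_separation hne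
    refine ⟨f '' U ∩ f '' V, fun z hz hzS ↦ ?_, (ho U hUo).inter (ho V hVo),
      ⟨⟨x₂, hx₂U, hfx₂⟩, ⟨x₁, hx₁V, rfl⟩⟩⟩
    obtain ⟨⟨a, haU, rfl⟩, ⟨b, hbV, hb⟩⟩ := hz
    obtain ⟨c, -, huniq⟩ := hzS
    exact hUV.ne_of_mem haU hbV ((huniq a rfl).trans (huniq b hb).symm)
  · exact ⟨(range f)ᶜ, fun z hz hzS ↦ hz hzS.exists, hr.isOpen_compl, hex⟩

end UniquelyCovered

open Summit.FinalStateConjecture.FinalStateConjecture.Theses.SignedCensus in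
/-- **CensusUniqueness** (item `stmt-FinalStateConjecture-10005` of route `SignedCensus`): a proper
local homeomorphism `chart : 𝔐 → B` from a Hausdorff space onto a connected (Hausdorff) space one of
whose fibres is a single point is injective. The set of points with exactly one preimage is clopen
(`isOpen_setOf_existsUnique_preimage`, `isClosed_setOf_existsUnique_preimage`) and nonempty, hence
all of `B`. -/
theorem censusUniqueness_proof :
    Summit.FinalStateConjecture.FinalStateConjecture.Theses.SignedCensus.CensusUniqueness := by
  unfold CensusUniqueness
  intro 𝔐 B _ _ _ _ _ chart hprop hloc hfib
  have hclopen : IsClopen {b : B | ∃! m, chart m = b} :=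
    ⟨isClosed_setOf_existsUnique_preimage hprop.isClosed_range hloc.isOpenMap,
      isOpen_setOf_existsUnique_preimage hprop.isClosedMap hloc.isOpenMap hloc.isLocallyInjective⟩
  have huniv : {b : B | ∃! m, chart m = b} = univ := hclopen.eq_univ hfib
  intro m₁ m₂ h
  exact (eq_univ_iff_forall.mp huniv (chart m₂)).unique h rfl

end SignedCensus

end Summit.FinalStateConjecture.FinalStateConjecture.Theorems
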